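/-
Origin: expansion seat `planner-pub-hodgecm-toy-g4-0`, handover #5 2026-08-18T13:22:43Z (md5 32dd7f8a) (`HOME/pub-hodgecm-toy-g4/lean/ToyG4/GeometricAll3.lean`, md5 32dd7f8a, 119 lines);
landed by the gen-8 packager in gate run 30 as `HodgeCM/Model/ToyG2/GeometricAll3.lean` (import ^import Pv03g7\.Gysin3[ \t]*$→import HodgeCM.Model.ToyG2.Gysin3 ×1; import ^import ToyG4\.ProdSection3[ \t]*$→import HodgeCM.Model.ToyG2.ProdSection3 ×1).
-/
/-
# The complete geometric record `ModelAxioms ∧ OpenInputsGeometric` in ONE model: `toyUniverse₃ d t`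

Generation 4 of the consistency-witness lineage (unit `pub-hodgecm-toy-g4`), file 5.  KERNEL; cites nothing, posits nothing.

Joins two RUN-30 leaves: pv03-g7's **F7 `toyUniverse₃_fact_gysin (d t) : (toyUniverse₃ d t).Fact_gysin`** (`Model/ToyG2/Gysin3.lean`,
no hypotheses) and this seat's `toyUniverse₃_openInputsGeometric_of_gysin` / `toyUniverse₃_geometricFacts_but_gysin_all`
(`Model/ToyG2/ProdSection3.lean`).  Results (namespace `HodgeCM.ToyG2`):

* `toyUniverse₃_openInputsGeometric_all (d t) (hd : 1 ≤ d) (ht : t² = 16) : (toyUniverse₃ d t).OpenInputsGeometric` — the RECORD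
  of `Assembly/OpenInputsGeometric.lean` (both realisation inputs, N1–N4, F2, F4, F5, F6, F7), no further hypotheses;
* **`exists_modelAxioms_and_openInputsGeometric : ∃ U, U.ModelAxioms ∧ U.OpenInputsGeometric`** — referee A's G4 for the OLDER,
  geometric end state `Assembly.COR_CM_of_openInputsGeometric`: its complete hypothesis list is jointly satisfiable;
* `toyModel_not_openInputsGeometric : ¬ toyModel.OpenInputsGeometric` (generation 1 refutes F6) and
  **`openInputsGeometric_independent`**: the record is INDEPENDENT of the 28 model axioms;
* `toyUniverse₃_geometricFacts_all` / `exists_geometricFacts_all`: ALL the `Universe`-level fact binders of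
  `COR_CM_of_openInputsGeometric` / `COR_CM_of_geometricFacts'` — `ModelAxioms ∧ R_PerL ∧ R_Face ∧ N1 ∧ N2 ∧ N3 ∧ N4 ∧ F2 ∧ F4 ∧ F5 ∧ F6
  ∧ F7 ∧ Fact_dimProd ∧ Fact_trTopCM ∧ Fact_prodSection` — jointly, in one model;
* `toyUniverse₃_hcCM_by_geometric (d t hd ht) : (toyUniverse₃ d t).HC_CM` — the geometric end state INSTANTIATED, unconditionally;
  likewise `toyUniverse₃_hcCM_by_geometricFacts` (`Assembly.COR_CM_of_geometricFacts`, with M29/M30 from toy-g3 and `Qw8Milne` =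
  `toyUniverse₃_qw8Milne` from qw8b-g2's `qw8Milne_of_genericFacts`), `toyUniverse₃_hcCM_by_geometricFacts'` (`StubTree/Qw8MilneZero`),
  `toyUniverse₃_hcCM_by_qw8Facts` (`Assembly.COR_CM_of_qw8Facts`, `PohlmannSpan` by `pohlmannSpan_of_facts`) — each of these end states
  APPLIED in the model, i.e. each of their complete binder lists is jointly satisfied by `toyUniverse₃ d t`.

(pv03-g7's `GenericFactsAll3.lean` does the same for the eleven binders of `COR_CM_of_genericFacts`; toy-g3's `OpenInputsAll3` /
`DescentFactsAll3` for `OpenInputs` and the (δ)-route lists.  After this file the end states `COR_CM_of_openInputs`,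
`…_of_descentFacts/B/B₄`, `…_of_genericFacts`, `…_of_openInputsGeometric`, `…_of_geometricFacts`, `…_of_geometricFacts'`, `…_of_qw8Facts`
ALL have their complete hypothesis lists witnessed in the single model `toyUniverse₃ 1 4`; the lists with the `∀ X` trace axiom T
(`COR_CM_of_genericFacts'`, `COR_CM_of_descentFacts'`) cannot — T is refuted for this universe in `NoTrTop3.lean` — and the
alternative input `Fact_fundClass` of `COR_CM_of_geometricFacts_fundClass` is not examined here.)
-/
import Summits.HodgeConjecture.HodgeCM.Assembly.CorCMQw8Facts
import Summits.HodgeConjecture.HodgeCM.Model.ToyG2.Gysin3_2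
import Summits.HodgeConjecture.HodgeCM.Model.ToyG2.ProdSection3

/-! PORT of `HodgeCM/Model/ToyG2/GeometricAll3.lean` (HodgeCMPerL run 82) — verbatim mechanical port; provenance in the PORT header line. -/

namespace HodgeCM.ToyG2

open Toy

section ToyUniverse

variable (d t : ℚ)

/-- **the record `OpenInputsGeometric` holds in `toyUniverse₃ d t`** (`1 ≤ d`, `t² = 16`; F7 by pv03-g7's `toyUniverse₃_fact_gysin`). -/
theorem toyUniverse₃_openInputsGeometric_all (hd : 1 ≤ d) (ht : t ^ 2 = 16) : (toyUniverse₃ d t).OpenInputsGeometric :=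
  toyUniverse₃_openInputsGeometric_of_gysin d t hd ht (toyUniverse₃_fact_gysin d t)

/-- **ALL the `Universe`-level fact binders of the geometric end states, jointly, in `toyUniverse₃ d t`** (`1 ≤ d`, `t² = 16`):
`ModelAxioms ∧ R_PerL ∧ R_Face ∧ N1 ∧ N2 ∧ N3 ∧ N4 ∧ F2 ∧ F4 ∧ F5 ∧ F6 ∧ F7 ∧ Fact_dimProd ∧ Fact_trTopCM ∧ Fact_prodSection`. -/
theorem toyUniverse₃_geometricFacts_all (hd : 1 ≤ d) (ht : t ^ 2 = 16) :
    (toyUniverse₃ d t).ModelAxioms ∧ (toyUniverse₃ d t).RealisationExistsPerL ∧ (toyUniverse₃ d t).RealisationExistsFace ∧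
      (toyUniverse₃ d t).Fact_cupExterior ∧ (toyUniverse₃ d t).Fact_cup_hodge ∧ (toyUniverse₃ d t).Fact_pull_H0 ∧
      (toyUniverse₃ d t).Fact_hodge_F0 ∧ (toyUniverse₃ d t).Fact_factorActDescends ∧ (toyUniverse₃ d t).Fact_cupAlg ∧
      (toyUniverse₃ d t).Fact_cupAssoc ∧ (toyUniverse₃ d t).Fact_weightDual ∧ (toyUniverse₃ d t).Fact_gysin ∧
      (toyUniverse₃ d t).Fact_dimProd ∧ (toyUniverse₃ d t).Fact_trTopCM ∧ (toyUniverse₃ d t).Fact_prodSection := by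
  obtain ⟨hM, hP, hR, h1, h2, h3, h4, hF2, hF4, hF5, hF6, hd', ht', hS⟩ := toyUniverse₃_geometricFacts_but_gysin_all d t hd ht
  exact ⟨hM, hP, hR, h1, h2, h3, h4, hF2, hF4, hF5, hF6, toyUniverse₃_fact_gysin d t, hd', ht', hS⟩

/-- **COR-CM in `toyUniverse₃ d t` by the GEOMETRIC end state** `Assembly.COR_CM_of_openInputsGeometric`, unconditionally
(`1 ≤ d`, `t² = 16`). -/
theorem toyUniverse₃_hcCM_by_geometric (hd : 1 ≤ d) (ht : t ^ 2 = 16) : (toyUniverse₃ d t).HC_CM :=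
  toyUniverse₃_hcCM_by_geometric_of_gysin d t hd ht (toyUniverse₃_fact_gysin d t)

/-- `Qw8Milne` holds in `toyUniverse₃ d t` (`1 ≤ d`, `t² = 16`): qw8b-g2's `Universe.qw8Milne_of_genericFacts` at the generic witnesses
(toy-g3) and F7 (pv03-g7). -/
theorem toyUniverse₃_qw8Milne (hd : 1 ≤ d) (ht : t ^ 2 = 16) : (toyUniverse₃ d t).Qw8Milne := by
  obtain ⟨hM, -, -, h1, h2, h3, h4, -, hF4, hF5, -, hd', ht', -⟩ := toyUniverse₃_geometricFacts_but_gysin_all d t hd ht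
  exact Universe.qw8Milne_of_genericFacts hM h1 h2 h3 h4 hF4 hF5 (toyUniverse₃_fact_gysin d t) hd' ht'

/-- **COR-CM in `toyUniverse₃ d t` by `Assembly.COR_CM_of_geometricFacts`** (binders `ModelAxioms`, `RealisationExistsFace`, M29
`Fact_weightSpan`, M30 `Fact_weightHodge`, F2, F4, F5, F6, F7, `Qw8Milne` — every one witnessed: M29/M30 by toy-g3's
`toyModel3_weightSpan` / `toyModel3_weightHodge`, `Qw8Milne` by `toyUniverse₃_qw8Milne`). -/
theorem toyUniverse₃_hcCM_by_geometricFacts (hd : 1 ≤ d) (ht : t ^ 2 = 16) : (toyUniverse₃ d t).HC_CM := by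
  obtain ⟨hM, -, hR, -, -, -, -, hF2, hF4, hF5, hF6, -, -, -⟩ := toyUniverse₃_geometricFacts_but_gysin_all d t hd ht
  exact Assembly.COR_CM_of_geometricFacts _ hM hR (toyModel3_weightSpan hM)
    (toyModel3_weightHodge hM) hF2 hF4 hF5 hF6 (toyUniverse₃_fact_gysin d t) (toyUniverse₃_qw8Milne d t hd ht)

/-- **COR-CM in `toyUniverse₃ d t` by `Assembly.COR_CM_of_geometricFacts'`** (`StubTree/Qw8MilneZero.lean`; binders `ModelAxioms`,
`RealisationExistsFace`, N1–N4, F2, F4, F5, F6, F7 — every one witnessed). -/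
theorem toyUniverse₃_hcCM_by_geometricFacts' (hd : 1 ≤ d) (ht : t ^ 2 = 16) : (toyUniverse₃ d t).HC_CM := by
  obtain ⟨hM, -, hR, h1, h2, h3, h4, hF2, hF4, hF5, hF6, -, -, -⟩ := toyUniverse₃_geometricFacts_but_gysin_all d t hd ht
  exact Assembly.COR_CM_of_geometricFacts' _ hM hR h1 h2 h3 h4 hF2 hF4 hF5 hF6 (toyUniverse₃_fact_gysin d t)

/-- **COR-CM in `toyUniverse₃ d t` by `Assembly.COR_CM_of_qw8Facts`** (binders `ModelAxioms`, `RealisationExistsFace`, `PohlmannSpan`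
— from N1–N4 by `Universe.pohlmannSpan_of_facts` — F2, F4, F5, F6, F7, `Qw8Milne`). -/
theorem toyUniverse₃_hcCM_by_qw8Facts (hd : 1 ≤ d) (ht : t ^ 2 = 16) : (toyUniverse₃ d t).HC_CM := by
  obtain ⟨hM, -, hR, h1, h2, h3, h4, hF2, hF4, hF5, hF6, -, -, -⟩ := toyUniverse₃_geometricFacts_but_gysin_all d t hd ht
  exact Assembly.COR_CM_of_qw8Facts _ hM hR (Universe.pohlmannSpan_of_facts hM h1 h2 h3 h4) hF2 hF4 hF5 hF6
    (toyUniverse₃_fact_gysin d t) (toyUniverse₃_qw8Milne d t hd ht)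

end ToyUniverse

/-- **G4 for the geometric end state: `ModelAxioms ∧ OpenInputsGeometric` is satisfiable** (witness `toyUniverse₃ 1 4`). -/
theorem exists_modelAxioms_and_openInputsGeometric : ∃ U : Universe, U.ModelAxioms ∧ U.OpenInputsGeometric :=
  ⟨toyUniverse₃ 1 4, toyUniverse₃_modelAxioms_all 1 4, toyUniverse₃_openInputsGeometric_all 1 4 le_rfl (by norm_num)⟩

/-- all fifteen conjuncts of `toyUniverse₃_geometricFacts_all` are jointly satisfiable -/
theorem exists_geometricFacts_all :
    ∃ U : Universe, U.ModelAxioms ∧ U.RealisationExistsPerL ∧ U.RealisationExistsFace ∧ U.Fact_cupExterior ∧ U.Fact_cup_hodge ∧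
      U.Fact_pull_H0 ∧ U.Fact_hodge_F0 ∧ U.Fact_factorActDescends ∧ U.Fact_cupAlg ∧ U.Fact_cupAssoc ∧ U.Fact_weightDual ∧
      U.Fact_gysin ∧ U.Fact_dimProd ∧ U.Fact_trTopCM ∧ U.Fact_prodSection :=
  ⟨toyUniverse₃ 1 4, toyUniverse₃_geometricFacts_all 1 4 le_rfl (by norm_num)⟩

/-- the generation-1 exterior model refutes the record (its F6 component: `Toy.not_fact_weightDual`) -/
theorem toyModel_not_openInputsGeometric : ¬ toyModel.OpenInputsGeometric :=
  fun I => not_fact_weightDual exteriorHodgeData I.weightDual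

/-- **`OpenInputsGeometric` is INDEPENDENT of the 28 model axioms**: it holds in `toyUniverse₃ 1 4` and fails in the
generation-1 `toyModel`, both models of `ModelAxioms`. -/
theorem openInputsGeometric_independent :
    (∃ U : Universe, U.ModelAxioms ∧ U.OpenInputsGeometric) ∧ ∃ U : Universe, U.ModelAxioms ∧ ¬ U.OpenInputsGeometric :=
  ⟨exists_modelAxioms_and_openInputsGeometric, toyModel, toyModel_modelAxioms, toyModel_not_openInputsGeometric⟩

/-- some universe satisfies `ModelAxioms ∧ OpenInputsGeometric` AND (therefore) COR-CM -/
theorem exists_openInputsGeometric_and_hcCM : ∃ U : Universe, (U.ModelAxioms ∧ U.OpenInputsGeometric) ∧ U.HC_CM :=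
  ⟨toyUniverse₃ 1 4, ⟨toyUniverse₃_modelAxioms_all 1 4, toyUniverse₃_openInputsGeometric_all 1 4 le_rfl (by norm_num)⟩,
    toyUniverse₃_hcCM_by_geometric 1 4 le_rfl (by norm_num)⟩

end HodgeCM.ToyG2
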